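import Literature.Probability.LatticeModels.PinningLemma
import Literature.Probability.LatticeModels.OrthogonalButterfliesCore
import HarnessLib

/-!
# The pinning bound (Georgii–Higuchi 2000, Lemma 5.2, conclusion)

Topic `Probability/LatticeModels`; theorems only. `PinningLemma.lean` proves the three quantitative
pieces of Georgii–Higuchi's pinning lemma (J. Math. Phys. 41 (2000), Lemma 5.2): the strong-Markov /
point-to-semicircuit bound `θ⁺(x)/2 · μ(SemiLeft m L x) ≤ 2 μ(PinLeft m x)` (`measureReal_pinLeft_ge`,
`θ⁺(x)` the `+∗`percolation probability of `x` under an auxiliary Gibbs measure), and the two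
approximation steps `μ(SemiLeft m L x) ≈ μ(LeftAnchored m x) ≈ μ(LeftAnchoredInf m)` for `L` large
and `x` far to the left. This file assembles them into the bound used in the proof of Lemma 5.5:
**if `LeftAnchoredInf m` holds almost surely, then `μ(PinLeft m x) ≥ θ/8` for all axis sites `x` far
enough to the left**, where `θ` is any lower bound for the `+∗`percolation probability of one fixed
site `z₀` under `μ` (`exists_pinLeft_bound`); the auxiliary measure is the translate of `μ` taking
`z₀` to `x`, so that `θ⁺(x) ≥ θ` uniformly in `x` (GH use the translation invariant `μ⁺`). Also:
`exists_pos_measureReal_plusStarCluster` — `θ > 0` for some `z₀` as soon as an infinite `+∗`cluster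
exists almost surely.

## References

* H.-O. Georgii, Y. Higuchi, J. Math. Phys. 41 (2000) 1153–1169, Lemma 5.2 [GeorgiiHiguchi2000].
-/

noncomputable section

open MeasureTheory Filter SimpleGraph
open Literature.Probability.Percolation
open scoped ENNReal

namespace Literature.Probability.LatticeModels

section Bound

variable {β : ℝ} {κ : Measure (SpinConfig (Site 2))}

/-- The `∗`-clusters of a shifted configuration are the shifted clusters (whole plane). [folklore] -/
theorem siteCluster_configShift_eq_image_star_plane (s : ℤˣ) (u : Site 2) (ω : SpinConfig (Site 2)) (y : Site 2) :
    siteCluster zdStarGraph (spinSites s (configShift u ω)) (y + u) =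
      (fun z : Site 2 => z + u) '' siteCluster zdStarGraph (spinSites s ω) y := by
  set φ := starShiftIso u with hφ
  have hcfg : (configShift (S := ℤˣ) u ω : SpinConfig (Site 2)) = configRelabel φ.toEquiv ω := rfl
  have hO : spinSites s (configShift (S := ℤˣ) u ω) = (φ : Site 2 → Site 2) '' spinSites s ω := by
    rw [hcfg, spinSites_configRelabel]; rfl
  have key : siteCluster zdStarGraph ((φ : Site 2 → Site 2) '' spinSites s ω) (φ y) =
      (φ : Site 2 → Site 2) '' siteCluster zdStarGraph (spinSites s ω) y := by
    have h := siteCluster_relabel φ (spinSites s ω) y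
    rwa [SiteConfig.relabel_apply] at h
  rw [hO, show y + u = φ y from rfl, key]
  rfl

/-- **The `+∗`percolation probability of `y + u` under the translate `κ ∘ θ_u⁻¹` is that of `y`
under `κ`.** [folklore] -/
theorem measureReal_infinite_plusStarCluster_map_configShift (κ : Measure (SpinConfig (Site 2))) (u y : Site 2) :
    (κ.map (configShift u)).real {ω : SpinConfig (Site 2) | (siteCluster zdStarGraph (spinSites 1 ω) (y + u)).Infinite} =
      κ.real {ω : SpinConfig (Site 2) | (siteCluster zdStarGraph (spinSites 1 ω) y).Infinite} := by
  classical
  have hmeas : MeasurableSet {ω : SpinConfig (Site 2) | (siteCluster zdStarGraph (spinSites 1 ω) (y + u)).Infinite} :=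
    measurable_spinSites 1 (measurableSet_sitePercolatesAt (G := zdStarGraph) (y + u))
  rw [measureReal_def, Measure.map_apply (configShift _).measurable hmeas, measureReal_def]
  congr 1
  congr 1
  ext ω
  simp only [Set.mem_preimage, Set.mem_setOf_eq]
  rw [siteCluster_configShift_eq_image_star_plane,
    Set.infinite_image_iff (Set.injOn_of_injective (fun a b h => add_right_cancel h))]

/-- **Some site percolates with positive probability** if an infinite `+∗`cluster exists almost
surely. [folklore] -/
theorem exists_pos_measureReal_plusStarCluster [IsProbabilityMeasure κ]
    (h : ∀ᵐ ω ∂κ, ∃ x, (siteCluster zdStarGraph (spinSites 1 ω) x).Infinite) :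
    ∃ z₀ : Site 2, 0 < κ.real {ω : SpinConfig (Site 2) | (siteCluster zdStarGraph (spinSites 1 ω) z₀).Infinite} := by
  classical
  by_contra hno
  push Not at hno
  have hzero : ∀ z : Site 2, κ {ω : SpinConfig (Site 2) | (siteCluster zdStarGraph (spinSites 1 ω) z).Infinite} = 0 := by
    intro z
    have h0 : κ.real {ω : SpinConfig (Site 2) | (siteCluster zdStarGraph (spinSites 1 ω) z).Infinite} = 0 :=
      le_antisymm (hno z) measureReal_nonneg
    rwa [measureReal_def, ENNReal.toReal_eq_zero_iff, or_iff_left (measure_ne_top _ _)] at h0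
  have hU : κ (⋃ z : Site 2, {ω : SpinConfig (Site 2) | (siteCluster zdStarGraph (spinSites 1 ω) z).Infinite}) = 0 :=
    measure_iUnion_null hzero
  have hae := measure_eq_zero_iff_ae_notMem.1 hU
  have : ∀ᵐ ω ∂κ, False := by
    filter_upwards [h, hae] with ω ⟨x, hx⟩ hω
    exact hω (Set.mem_iUnion.2 ⟨x, hx⟩)
  obtain ⟨ω, hω⟩ := this.exists
  exact hω

/-- **The pinning bound** (Georgii–Higuchi 2000, Lemma 5.2): for `β ≥ 0`, `κ ∈ 𝒢(β, 0)`, a site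
`z₀` with `+∗`percolation probability `≥ θ`, and `m` such that `LeftAnchoredInf m` holds almost
surely, there is `a₀` such that `θ/8 ≤ κ(PinLeft m x)` for every axis site `x` with `x₁ ≤ -a₀`. [cite: GeorgiiHiguchi2000, Lemma 5.2] -/
theorem exists_pinLeft_bound (hβ : 0 ≤ β) (hκ : κ ∈ isingGibbsMeasures 2 β 0) {θ : ℝ} {z₀ : Site 2}
    (hθ : θ ≤ κ.real {ω : SpinConfig (Site 2) | (siteCluster zdStarGraph (spinSites 1 ω) z₀).Infinite}) (m : ℕ)
    (hA : ∀ᵐ ω ∂κ, LeftAnchoredInf m ω) :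
    ∃ a₀ : ℕ, ∀ x : Site 2, x 1 = 0 → x 0 ≤ -(a₀ : ℤ) → θ / 8 ≤ κ.real {ω | PinLeft m x ω} := by
  classical
  have hκG : IsGibbsMeasure (isingSpecification (zdGraph 2) β 0) κ := hκ
  haveI := hκG.isProbabilityMeasure
  -- `LeftAnchoredInf m` has probability one
  have hAI : κ.real {ω | LeftAnchoredInf m ω} = 1 := by
    have h0 : κ {ω | LeftAnchoredInf m ω}ᶜ = 0 := by
      rw [measure_eq_zero_iff_ae_notMem]
      filter_upwards [hA] with ω hω h
      exact h hω
    have h1 := (prob_compl_eq_zero_iff (measurableSet_leftAnchoredInf (m := m))).1 h0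
    rw [measureReal_def, h1, ENNReal.toReal_one]
  obtain ⟨N₀, hN₀⟩ := measureReal_leftAnchored_ge hκ m (ε := 1 / 4) (by norm_num)
  refine ⟨max N₀ (m + 1), fun x hx1 hx0 => ?_⟩
  have hLA : 3 / 4 ≤ κ.real {ω | LeftAnchored m x ω} := by
    have := hN₀ x (by omega)
    rw [hAI] at this; linarith
  obtain ⟨L₀, hL₀⟩ := measureReal_semiLeft_eventually_ge hκ m x (ε := 1 / 4) (by norm_num)
  have hS : 1 / 2 ≤ κ.real {ω | SemiLeft m L₀ x ω} := by
    have := hL₀ L₀ le_rfl; linarith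
  -- the auxiliary measure: the translate taking `z₀` to `x`
  set κ' : Measure (SpinConfig (Site 2)) := κ.map (configShift (x - z₀)) with hκ'
  have hκ'G : κ' ∈ isingGibbsMeasures 2 β 0 := mem_isingGibbsMeasures_map_configShift hκ _
  have hθ' : θ ≤ κ'.real {ω : SpinConfig (Site 2) | (siteCluster zdStarGraph (spinSites 1 ω) x).Infinite} := by
    have key := measureReal_infinite_plusStarCluster_map_configShift κ (x - z₀) z₀
    rw [add_sub_cancel] at key
    rw [hκ', key]; exact hθ
  have hpin := measureReal_pinLeft_ge hβ hκ hκ'G m L₀ hx1 (show x 0 < -(m : ℤ) by omega)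
  have hprod : θ / 2 * (1 / 2) ≤
      κ'.real {ω : SpinConfig (Site 2) | (siteCluster zdStarGraph (spinSites 1 ω) x).Infinite} / 2 * κ.real {ω | SemiLeft m L₀ x ω} :=
    mul_le_mul (by linarith) hS (by norm_num) (by positivity)
  linarith

end Bound

end Literature.Probability.LatticeModels
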